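import Mathlib
import Summits.Ventures.HodgeRepro.Tier4.Target
import Summits.Ventures.HodgeRepro.Tier4.Common.TargetBall
import Summits.Ventures.HodgeRepro.Tier4.Common.TargetCalculus
import Summits.Ventures.HodgeRepro.Tier4.Common.AutForms
import Summits.Ventures.HodgeRepro.Tier4.Line3.KMDatumS

/-!
# Tier4/Line3/MajorantLemmas — Mathlib-level lemmas for L3.2a `integrable_majorant` of LINE L3

Blind re-derivation cell `pub-hodge-repro`, Tier 4 «PROVE THE STEP» (README §9–§10), seat t4-L2-p1 (gen 0), on LINE L3
(`Tier4/Line3/Skeleton.lean` v0.14, t4-plan-3) by the lead's assignment S12208.  Support module of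
`Tier4/Line3/IntegrableMajorant.lean` (the gate caps proof files at 400 lines): summability bookkeeping (list sums,
products over `Fin n → α`), the bound `‖a ∧ b‖ ≤ (‖a₀‖ + ‖a₁‖)(‖b₀‖ + ‖b₁‖)`, the continuity of the sesquilinear datumS
`Φ(y, z)_k = (ȳ ⬝ A z k y) e^{−π (y,y)_z}` on the ball and the compactness of `{nsq ≤ r}` (restated after t4-L3-p1's
`KernelBounds` §2–§3, which concerned the earlier datumS shape), and the boundedness of the partial derivatives of the
ball action `actM M`, `M ∈ U(2,1)`, on compacts of the ball.  No printed input enters.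
Nothing here says anything about the status of the Hodge conjecture for CM abelian varieties, which is NOT proved
(HC_CM is NOT proved by anyone in this repository).
-/

set_option autoImplicit false

noncomputable section

namespace Summit.Ventures.HodgeRepro.Tier4.Line3

open Summit.Ventures.HodgeRepro.Tier4
open Matrix MeasureTheory
open scoped ComplexConjugate

namespace IntegrableMajorant

/-! ### 1. Summability bookkeeping: list sums, norms of list sums, products over `Fin n → α` -/

/-- A list sum of summable real functions is summable. -/
theorem summable_list_sum {ι β : Type} (l : List ι) (A : ι → β → ℝ) (hA : ∀ t ∈ l, Summable (A t)) :
    Summable (fun o => (l.map (fun t => A t o)).sum) := by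
  induction l with
  | nil =>
    simp only [List.map_nil, List.sum_nil]
    exact summable_zero
  | cons t l ih =>
    simp only [List.map_cons, List.sum_cons]
    exact (hA t (by simp)).add (ih (fun t' ht' => hA t' (by simp [ht'])))

/-- The norm of a list sum is at most the list sum of the norms. -/
theorem norm_list_sum_le {ι : Type} (l : List ι) (f : ι → ℂ) :
    ‖(l.map f).sum‖ ≤ (l.map (fun t => ‖f t‖)).sum := by
  induction l with
  | nil => simp
  | cons t l ih =>
    simp only [List.map_cons, List.sum_cons]
    exact (norm_add_le _ _).trans (add_le_add le_rfl ih)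

/-- Termwise comparison of list sums. -/
theorem list_sum_le_list_sum {ι : Type} (l : List ι) (f g : ι → ℝ) (h : ∀ t ∈ l, f t ≤ g t) :
    (l.map f).sum ≤ (l.map g).sum := by
  induction l with
  | nil => simp
  | cons t l ih =>
    simp only [List.map_cons, List.sum_cons]
    exact add_le_add (h t (by simp)) (ih (fun t' ht' => h t' (by simp [ht'])))

/-- A product of non-negative summable functions, one per coordinate, is summable over `Fin n → α`. -/
theorem summable_pi_prod {α : Type} :
    ∀ {n : ℕ} (f : Fin n → α → ℝ), (∀ i, Summable (f i)) → (∀ i a, 0 ≤ f i a) →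
      Summable (fun w : Fin n → α => ∏ i, f i (w i)) := by
  intro n
  induction n with
  | zero =>
    intro f _ _
    haveI : Unique (Fin 0 → α) := Pi.uniqueOfIsEmpty _
    exact Summable.of_finite
  | succ n ih =>
    intro f hf hf0
    have hg : Summable (fun w : Fin n → α => ∏ i, f i.succ (w i)) :=
      ih (fun i => f i.succ) (fun i => hf _) (fun i a => hf0 _ _)
    have hf0' : (0 : α → ℝ) ≤ f 0 := fun a => hf0 0 a
    have hg0 : (0 : (Fin n → α) → ℝ) ≤ fun w : Fin n → α => ∏ i, f i.succ (w i) :=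
      fun w => Finset.prod_nonneg (fun i _ => hf0 _ _)
    have h2 := Summable.mul_of_nonneg (hf 0) hg hf0' hg0
    refine (Fin.consEquiv (fun _ : Fin (n + 1) => α)).summable_iff.mp (h2.congr fun p => ?_)
    show f 0 p.1 * ∏ i, f i.succ (p.2 i) = ∏ i, f i ((Fin.cons p.1 p.2 : Fin (n + 1) → α) i)
    rw [Fin.prod_univ_succ]
    simp

/-- `‖a ∧ b‖ ≤ (‖a₀‖ + ‖a₁‖)(‖b₀‖ + ‖b₁‖)`. -/
theorem norm_wedge_le (a b : Fin 2 → ℂ) : ‖wedge a b‖ ≤ (‖a 0‖ + ‖a 1‖) * (‖b 0‖ + ‖b 1‖) := by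
  unfold wedge
  calc ‖a 0 * b 1 - a 1 * b 0‖ ≤ ‖a 0 * b 1‖ + ‖a 1 * b 0‖ := norm_sub_le _ _
    _ = ‖a 0‖ * ‖b 1‖ + ‖a 1‖ * ‖b 0‖ := by rw [norm_mul, norm_mul]
    _ ≤ (‖a 0‖ + ‖a 1‖) * (‖b 0‖ + ‖b 1‖) := by
      nlinarith [norm_nonneg (a 0), norm_nonneg (a 1), norm_nonneg (b 0), norm_nonneg (b 1),
        mul_nonneg (norm_nonneg (a 0)) (norm_nonneg (b 0)), mul_nonneg (norm_nonneg (a 1)) (norm_nonneg (b 1))]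

/-! ### 1b. Continuity of the datumS on the ball and the compact `{nsq ≤ r}` (after t4-L3-p1's `KernelBounds` §2–§3,
restated here for the sesquilinear datum `datumS` of Skeleton v0.14 so that this module depends on `KMDatumS` alone) -/

/-- `{nsq ≤ r}` is compact for `r ≤ 1` (closed and bounded in `ℂ²`). -/
theorem isCompact_nsq_le' (r : ℝ) (hr : r ≤ 1) : IsCompact {z : Fin 2 → ℂ | nsq z ≤ r} := by
  refine Metric.isCompact_of_isClosed_isBounded (isClosed_le continuous_nsq continuous_const) ?_
  refine (Metric.isBounded_closedBall (x := (0 : Fin 2 → ℂ)) (r := 1)).subset fun z hz => ?_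
  rw [Metric.mem_closedBall, dist_zero_right, pi_norm_le_iff_of_nonneg zero_le_one]
  intro k
  have hk : ‖z k‖ ^ 2 ≤ 1 := by
    have : ‖z 0‖ ^ 2 + ‖z 1‖ ^ 2 ≤ 1 := le_trans hz hr
    fin_cases k <;> simp only [Fin.zero_eta, Fin.mk_one] <;> nlinarith [sq_nonneg ‖z 0‖, sq_nonneg ‖z 1‖]
  exact (pow_le_one_iff_of_nonneg (norm_nonneg _) two_ne_zero).mp hk

/-- `z ↦ w_z^* J y` is continuous (`w_z = lift3 z` is affine in `z`). -/
theorem continuous_lift3_dot' (y : Fin 3 → ℂ) : Continuous (fun z : Fin 2 → ℂ => star (lift3 z) ⬝ᵥ (J *ᵥ y)) := by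
  simp only [dotProduct, Fin.sum_univ_three, lift3]
  fun_prop

/-- The majorant `maj y` is continuous on the ball. -/
theorem continuousOn_maj' (y : Fin 3 → ℂ) : ContinuousOn (maj y) ball := by
  unfold maj
  refine continuousOn_const.add ?_
  refine ContinuousOn.div (continuousOn_const.mul ((continuous_lift3_dot' y).norm.pow 2).continuousOn)
    (continuousOn_const.sub continuous_nsq.continuousOn) ?_
  intro z hz
  exact ne_of_gt (sub_pos.mpr hz)

/-- `z ↦ ȳ ⬝ A z k y` is continuous on the ball (entrywise continuity of `A`). -/
theorem continuousOn_star_dotProduct_A (Φ : KMDatumS) (y : Fin 3 → ℂ) (k : Fin 2) :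
    ContinuousOn (fun z => star y ⬝ᵥ (Φ.A z k *ᵥ y)) ball := by
  simp only [dotProduct, Matrix.mulVec]
  refine continuousOn_finsetSum _ fun i _ => continuousOn_const.mul ?_
  exact continuousOn_finsetSum _ fun j _ => (Φ.cont k i j).mul continuousOn_const

/-- `datumS Φ y · k` is continuous on the ball. -/
theorem continuousOn_datum' (Φ : KMDatumS) (y : Fin 3 → ℂ) (k : Fin 2) :
    ContinuousOn (fun z => datumS Φ y z k) ball := by
  unfold datumS
  exact (continuousOn_star_dotProduct_A Φ y k).mul
    (Complex.continuous_ofReal.comp_continuousOn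
      (Real.continuous_exp.comp_continuousOn (continuousOn_const.mul (continuousOn_maj' y))))

/-- The wedge `Φ(ya, z) ∧ Φ(yb, z)` is continuous on the ball. -/
theorem continuousOn_wedge_datum' (Φ : KMDatumS) (ya yb : Fin 3 → ℂ) :
    ContinuousOn (fun z => wedge (datumS Φ ya z) (datumS Φ yb z)) ball := by
  unfold wedge
  exact ((continuousOn_datum' Φ ya 0).mul (continuousOn_datum' Φ yb 1)).sub
    ((continuousOn_datum' Φ ya 1).mul (continuousOn_datum' Φ yb 0))

/-! ### 2. The derivatives of the ball action are bounded on compacts of the ball -/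

/-- `z ↦ ∂_k (actM M)_l z` is bounded on a compact subset of the ball, for `M ∈ U(2,1)`. -/
theorem exists_bound_pd_actM {M : Matrix (Fin 3) (Fin 3) ℂ} (hM : Mᴴ * J * M = J)
    {K₀ : Set (Fin 2 → ℂ)} (hK : IsCompact K₀) (hKb : K₀ ⊆ ball) (k l : Fin 2) :
    ∃ B : ℝ, ∀ z ∈ K₀, ‖pd k (fun w => actM M w l) z‖ ≤ B := by
  have hnum : ContDiff ℂ 1 (fun z : Fin 2 → ℂ => (M *ᵥ lift3 z) (Fin.castSucc l)) := by
    have : (fun z : Fin 2 → ℂ => (M *ᵥ lift3 z) (Fin.castSucc l)) =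
        fun z => M (Fin.castSucc l) 0 * z 0 + M (Fin.castSucc l) 1 * z 1 + M (Fin.castSucc l) 2 := by
      funext z
      exact mulVec_lift3_apply M z _
    rw [this]
    fun_prop
  have hden : ContDiff ℂ 1 (fun z : Fin 2 → ℂ => (M *ᵥ lift3 z) 2) := by
    have : (fun z : Fin 2 → ℂ => (M *ᵥ lift3 z) 2) = fun z => M 2 0 * z 0 + M 2 1 * z 1 + M 2 2 := by
      funext z
      exact mulVec_lift3_apply M z _
    rw [this]
    fun_prop
  have hcd : ContDiffOn ℂ 1 (fun w => actM M w l) ball := by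
    have : (fun w => actM M w l) = fun w => (M *ᵥ lift3 w) (Fin.castSucc l) / (M *ᵥ lift3 w) 2 := rfl
    rw [this]
    exact hnum.contDiffOn.div hden.contDiffOn (fun z hz => mulVec_lift3_two_ne_zero hM hz)
  have hc : ContinuousOn (fun z => pd k (fun w => actM M w l) z) ball := by
    have := hcd.continuousOn_fderiv_of_isOpen isOpen_ball le_rfl
    exact this.clm_apply continuousOn_const
  exact hK.exists_bound_of_continuousOn (hc.mono hKb)

end IntegrableMajorant

end Summit.Ventures.HodgeRepro.Tier4.Line3

end
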